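import Summits.ABC.IUTFork.Repair.CandMochizuki6
import Summits.ABC.IUTFork.Repair.ProfileHeight
import HarnessLib

/-!
# IUT REPAIR branch (rung LADDER-ABC:A2.RP), class (ii) MOCHIZUKI'S REPLIES — rows RP-M36c / RP-M36d ON THE HEIGHT AXIS:
# READING 0 (`CandMochizuki6.H''`) holds at `shellHSetting p h d` iff `3h ≤ d` (= the Licence's hold-set), `H'''` iff `3h ≤ 2d`

Proof-only companion (0 definitions). AUTHORED BY abc-iut-rp-m2 (gen 2): the section below is rp-m2's staged text
`HOME/staging/repair/m2/HeightSection.lean.txt` (2026-08-26T08:45Z) VERBATIM, filed by the kernel hand abc-iut-w5-d133 (gen 4) at rp-m2's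
request (HOME/STATUS 09:04:19Z (3): «any hand may file them verbatim as Repair/CandMochizuki6Height.lean when the module builds») once the
module `Summits.ABC.IUTFork.Repair.ProfileHeight` (p429379, this hand's height-parametrised log-shell PROFILE family `shellHSetting p h d`:
q-parameter of height `h`, honest `j²`-scaled Θ-regions `B_{h·j² − d}`, log-shell inflation exponent `d`) was built on the farm.
TAKES NO SIDE on [IUTchIII] Cor. 3.12 or on any author; candidates are hypotheses (`CandMochizuki6.H''`, `H'''`: [IUTchIII] (f_itw) p. 189
l. 43–51 read per packet / globally — see `Repair/CandMochizuki6.lean`); a toy family models the typed interface, not IUT's intended data;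
typed ≠ proved. S. Mochizuki, *Inter-universal Teichmüller theory III*, kurims (May 2020) = `paper:url-4b091feeb646`.
[claim: Mochizuki2012, status: disputed]

RESULTS (every prime `p`, every `h`, `d`): `M36c_shellH_packet_iff` (per packet: READING 0's inequality is `h·j² − d ≤ h`),
**`M36c_shellH_iff : H'' ⟺ 3·h ≤ d`**, `M36c_shellH_iff_licence` (READING 0 and the (xi-f) Licence have THE SAME hold-set on the height
axis — concentric balls: «volume ≤» = «⊆»), **`M36d_shellH_iff : H''' ⟺ 3·h ≤ 2·d`** (= the typed Statement, `shellH_statement_iff`),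
`M36c_M36d_separate_shellH` (`h ≥ 1`, `d = 2h`: `H'''` holds, `H''` fails — READING 0 is STRICTLY stronger than the Statement along the
whole height axis). Standard axioms only.
-/

noncomputable section

open Set

namespace Summit.ABC.IUTFork.Repair.CandMochizuki6Height

open Thm311 Cor312 Cor312Vol Literature.IUT.LogThetaLattice
open Cor312Vol.PinnedWitness Cor312Vol.PinnedHonest Cor312Vol.NaiveWitness Cor312.Checks Cor312.IdentifiedNonVacuity

variable (p : ℕ) [hp : Fact p.Prime]

/-! ## 4. H — abc-iut-w5-d133's height axis `shellHSetting p h d`: READING 0 is the Licence's inequality `3h ≤ d` -/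

section Height

open ProfileHeight

variable (h d : ℕ)

/-- Per packet at `j = i + 1`: READING 0's inequality `qLocal ≤ thetaLocal` on the height bed is `h·j² − d ≤ h`. [folklore] -/
theorem M36c_shellH_packet_iff (i : Fin toyIndex.lstar) (vQ : toyIndex.VQ) :
    (shellHSetting p h d).qLocal (Setting.labelSucc i) vQ ≤ ((shellHSetting p h d).thetaLocal (Setting.labelSucc i) vQ).untopD 0 ↔
      (h : ℤ) * jsq (Setting.labelSucc i) - d ≤ h := by
  have hl := log_p_pos p
  rw [shellH_qLocal_labelSucc, shellH_thetaLocal, WithTop.untopD_coe]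
  -- (kernel-hand fix of the staged text: the cast bookkeeping is done by `le_of_mul_le_mul_right` instead of `nlinarith`)
  constructor
  · intro hle
    have h1 : (((h : ℤ) * jsq (Setting.labelSucc i) - d : ℤ) : ℝ) * Real.log p ≤ ((h : ℤ) : ℝ) * Real.log p := by
      push_cast at hle ⊢; linarith
    exact_mod_cast le_of_mul_le_mul_right h1 hl
  · intro hle
    have h1 : (((h : ℤ) * jsq (Setting.labelSucc i) - d : ℤ) : ℝ) ≤ ((h : ℤ) : ℝ) := by exact_mod_cast hle
    have h2 := mul_le_mul_of_nonneg_right h1 hl.le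
    push_cast at h2 ⊢; linarith

/-- **RP-M36c (READING 0) on the height axis: `H'' ⟺ 3·h ≤ d`** — the deep label `j = 2` decides (`4h − d ≤ h`); this is EXACTLY the Licence's
hold-set `ProfileHeight.shellH_licence_iff` (concentric balls: «volume ≤» = «⊆»). [folklore] -/
theorem M36c_shellH_iff : CandMochizuki6.H'' (naiveFullH p h).toLatticeSituation (shellHSetting p h d) ↔ 3 * h ≤ d := by
  have hj4 : jsq (Setting.labelSucc (T := toyIndex) ⟨1, by decide⟩) = 4 := by decide
  constructor
  · intro H
    have h2 := (M36c_shellH_packet_iff p h d ⟨1, by decide⟩ ()).1 (H ⟨1, by decide⟩ ())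
    rw [hj4] at h2
    omega
  · intro hd i vQ
    rw [M36c_shellH_packet_iff]
    have hj : jsq (Setting.labelSucc i) ≤ 4 := by
      unfold jsq
      have hi : ((Setting.labelSucc i : toyIndex.Label) : ℕ) ≤ 2 := Nat.le_of_lt_succ (Setting.labelSucc i).isLt
      have : ((Setting.labelSucc i : toyIndex.Label) : ℕ) ^ 2 ≤ 2 ^ 2 := Nat.pow_le_pow_left hi 2
      exact_mod_cast this
    have hj0 : 0 ≤ jsq (Setting.labelSucc i) := by unfold jsq; positivity
    have hd' : (3 : ℤ) * h ≤ d := by exact_mod_cast hd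
    nlinarith

/-- READING 0 and the Licence have THE SAME hold-set on the height axis. [folklore] -/
theorem M36c_shellH_iff_licence :
    CandMochizuki6.H'' (naiveFullH p h).toLatticeSituation (shellHSetting p h d) ↔ Thm311ToCor312.Licence (shellHSetting p h d) := by
  rw [M36c_shellH_iff, shellH_licence_iff]

/-- **RP-M36d on the height axis: `H''' ⟺ 3·h ≤ 2·d`** (= the Statement's `shellH_statement_iff`). [folklore] -/
theorem M36d_shellH_iff : CandMochizuki6.H''' (naiveFullH p h).toLatticeSituation (shellHSetting p h d) ↔ 3 * h ≤ 2 * d := by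
  rw [CandMochizuki6.H'''_iff_statement _ _ (shellH_thetaFinite p h d), shellH_statement_iff]

/-- **READING 0 is STRICTLY STRONGER than the Statement along the whole height axis**: at `d = 2h` (e.g. `(h, d) = (1, 2)`) the Statement /
`H'''` hold and `H''` fails (`3h ≤ 4h` but `3h ≰ 2h` for `h ≥ 1`). [folklore] -/
theorem M36c_M36d_separate_shellH (hh : 0 < h) :
    CandMochizuki6.H''' (naiveFullH p h).toLatticeSituation (shellHSetting p h (2 * h)) ∧
      ¬ CandMochizuki6.H'' (naiveFullH p h).toLatticeSituation (shellHSetting p h (2 * h)) := by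
  rw [M36d_shellH_iff, M36c_shellH_iff]
  omega

end Height


end Summit.ABC.IUTFork.Repair.CandMochizuki6Height

end
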